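import Mathlib.Analysis.InnerProductSpace.Basic
import Mathlib.Algebra.Order.Chebyshev
import HarnessLib

/-!
# Van der Corput's inequality with a dilation, for inner-product-space-valued sequences (Mauduit–Rivat 2015, Lemma 3; proved)

Everything in this file is PROVED (plus one plain definition). Mauduit–Rivat, *Prime numbers
along Rudin–Shapiro sequences*, J. Eur. Math. Soc. 17 (2015), Lemma 3 (from Mauduit–Rivat 2010,
Lemme 17): "For any `(z₁,…,z_N) ∈ ℂ^N` and any integers `k, R ≥ 1`,
`|∑_{n≤N} z_n|² ≤ ((N + kR − k)/R) (∑ |z_n|² + 2 ∑_{1≤r<R} (1 − r/R) Re ∑_{n ≤ N−kr} z_{n+kr} z̄_n)`."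
C. Müllner, Duke Math. J. 166 (2017), §5.4 uses it for MATRIX-valued sequences with the
Frobenius inner product ("When applying the Van-der-Corput inequality … we need again to keep
the correct order of terms"). We prove it for sequences with values in a complex inner-product
space `E`, indexed by `ℤ` and supported in `(a, b]`, in the Graham–Kolesnik shape of the tree's
scalar `VdC.vanDerCorput_ineq` (`VanDerCorputZeta.lean`) with a dilation `k`:

* `corrE z a b d = ∑_{a<n≤b} ⟪z(n+d), z(n)⟫` — the correlation (a complex number);
* `vanDerCorput_dilated` — for `1 ≤ H`, `1 ≤ k`, `a ≤ b`:
  `H² ‖∑_{a<n≤b} z(n)‖² ≤ (b − a + kH) · H · (∑ ‖z(n)‖² + 2 ∑_{1≤d<H} ‖corrE z a b (kd)‖)`,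
  i.e. `‖∑ z‖² ≤ ((b−a+kH)/H)(∑‖z‖² + 2∑_{d<H} |C(kd)|)` — the printed bound with the weights
  `(1 − r/R)` and real parts majorised by absolute values (all that the type-II argument uses).

## References
* C. Mauduit, J. Rivat, J. Eur. Math. Soc. 17 (2015), Lemma 3 (p. 2601). [MauduitRivat2015]
* C. Müllner, Duke Math. J. 166 (2017), §5.4 (proof of Prop. 5.5). [Mullner2017]
* S. W. Graham, G. Kolesnik, *Van der Corput's method of exponential sums*, Lemma 2.5.
  [GrahamKolesnik1991]
-/

noncomputable section

open Finset Complex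
open scoped InnerProductSpace ComplexConjugate

namespace Literature.NumberTheory.LFunctions.MauduitRivat

variable {E : Type*} [NormedAddCommGroup E] [InnerProductSpace ℂ E]

/-- The correlation `C(d) = ∑_{a<n≤b} ⟪z(n+d), z(n)⟫` of an `E`-valued sequence.
[cite: MauduitRivat2015, Lemma 3] -/
def corrE (z : ℤ → E) (a b d : ℤ) : ℂ := ∑ n ∈ Ioc a b, ⟪z (n + d), z n⟫_ℂ

/-- `C(0) = ∑ ‖z(n)‖²`. [folklore] -/
theorem corrE_zero (z : ℤ → E) (a b : ℤ) :
    corrE z a b 0 = ((∑ n ∈ Ioc a b, ‖z n‖ ^ 2 : ℝ) : ℂ) := by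
  rw [corrE]; push_cast
  exact sum_congr rfl fun n _ => by rw [add_zero, inner_self_eq_norm_sq_to_K]; norm_cast

/-- Sums of a function vanishing outside `T ⊆ A` over `A` and over `T` agree. [folklore] -/
theorem sum_eq_sum_of_vanish' {M : Type*} [AddCommMonoid M] {w : ℤ → M} {A T : Finset ℤ}
    (hT : T ⊆ A) (hw : ∀ n, n ∉ T → w n = 0) : ∑ n ∈ A, w n = ∑ n ∈ T, w n :=
  (sum_subset hT fun n _ hn => hw n hn).symm

/-- Shifting the summation variable. [folklore] -/
theorem sum_Ioc_shift' {M : Type*} [AddCommMonoid M] (w : ℤ → M) (c d t : ℤ) :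
    ∑ m ∈ Ioc c d, w (m + t) = ∑ n ∈ Ioc (c + t) (d + t), w n := by
  rw [← map_add_right_Ioc, sum_map]; rfl

/-- `‖∑ x_j‖² = ∑_{j,j'} Re ⟪x_j, x_{j'}⟫` in an inner-product space. [folklore] -/
theorem norm_sq_sum_eq_re_inner (J : Finset ℕ) (x : ℕ → E) :
    ‖∑ j ∈ J, x j‖ ^ 2 = ∑ j ∈ J, ∑ j' ∈ J, (⟪x j, x j'⟫_ℂ).re := by
  rw [← inner_self_eq_norm_sq (𝕜 := ℂ), sum_inner, map_sum]
  refine sum_congr rfl fun j _ => ?_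
  rw [inner_sum, map_sum]
  simp only [RCLike.re_to_complex]

omit [InnerProductSpace ℂ E] in
/-- Cauchy–Schwarz: `‖∑_{m∈M} w(m)‖² ≤ #M ∑ ‖w(m)‖²`. [folklore] -/
theorem norm_sq_sum_le_card_mul' (M : Finset ℤ) (w : ℤ → E) :
    ‖∑ m ∈ M, w m‖ ^ 2 ≤ M.card * ∑ m ∈ M, ‖w m‖ ^ 2 :=
  le_trans (pow_le_pow_left₀ (norm_nonneg _) (norm_sum_le _ _) 2) sq_sum_le_card_mul_sum_sq

section Support

variable {z : ℤ → E} {a b : ℤ} (hz : ∀ n, n ∉ Ioc a b → z n = 0)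
include hz

/-- `‖C(-d)‖ = ‖C(d)‖` (`C(-d)` is the conjugate of a shifted copy of `C(d)`, and the shift is
absorbed by the support). [folklore] -/
theorem norm_corrE_neg (d : ℤ) : ‖corrE z a b (-d)‖ = ‖corrE z a b d‖ := by
  have h : corrE z a b (-d) = conj (corrE z a b d) := by
    rw [corrE, corrE, map_sum]
    -- `∑_{n} ⟪z(n-d), z(n)⟫ = ∑_{m} ⟪z(m), z(m+d)⟫` by `m = n - d`, both over all supports
    have h1 : ∑ n ∈ Ioc a b, ⟪z (n + -d), z n⟫_ℂ = ∑ n ∈ Ioc (a - |d| - |d|) (b + |d|), ⟪z (n + -d), z n⟫_ℂ := by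
      refine (sum_eq_sum_of_vanish' (Ioc_subset_Ioc (by linarith [abs_nonneg d]) (by linarith [abs_nonneg d])) ?_).symm
      intro n hn; rw [hz n hn, inner_zero_right]
    have h2 : ∑ n ∈ Ioc a b, conj ⟪z (n + d), z n⟫_ℂ =
        ∑ m ∈ Ioc (a - |d| - |d|) (b + |d|), ⟪z (m + -d), z m⟫_ℂ := by
      have h3 : ∑ n ∈ Ioc a b, conj ⟪z (n + d), z n⟫_ℂ =
          ∑ n ∈ Ioc (a - |d| - |d| - d) (b + |d| - d), conj ⟪z (n + d), z n⟫_ℂ := by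
        refine (sum_eq_sum_of_vanish' (Ioc_subset_Ioc (by cases abs_cases d <;> linarith)
          (by cases abs_cases d <;> linarith)) ?_).symm
        intro n hn; rw [hz n hn, inner_zero_right, map_zero]
      rw [h3]
      have h4 := sum_Ioc_shift' (fun m => ⟪z (m + -d), z m⟫_ℂ) (a - |d| - |d| - d) (b + |d| - d) d
      simp only [sub_add_cancel] at h4
      rw [← h4]
      refine sum_congr rfl fun n _ => ?_
      rw [inner_conj_symm, show n + d + -d = n by ring]
    rw [h1, h2]
  rw [h, Complex.norm_conj]

/-- **Van der Corput's inequality with dilation `k`, `E`-valued** (Mauduit–Rivat 2015, Lemma 3,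
in absolute-value form): for `z` supported in `(a, b]`, `a ≤ b`, `1 ≤ H`, `1 ≤ k`,
`H² ‖∑ z(n)‖² ≤ (b − a + kH) · H · (∑ ‖z(n)‖² + 2 ∑_{1≤d<H} ‖C(kd)‖)`.
[cite: MauduitRivat2015, Lemma 3] -/
theorem vanDerCorput_dilated (hab : a ≤ b) {H : ℕ} (hH : 1 ≤ H) {k : ℤ} (hk : 1 ≤ k) :
    (H : ℝ) ^ 2 * ‖∑ n ∈ Ioc a b, z n‖ ^ 2 ≤
      ((b : ℝ) - a + k * H) * (H * (∑ n ∈ Ioc a b, ‖z n‖ ^ 2 +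
        2 * ∑ d ∈ Ico (1 : ℤ) H, ‖corrE z a b (k * d)‖)) := by
  set S := ∑ n ∈ Ioc a b, z n with hS
  set M : Finset ℤ := Ioc (a - k * H) b with hM
  have hkH : 0 ≤ k * H := by positivity
  have hcardM : (M.card : ℝ) = (b : ℝ) - a + k * H := by
    rw [hM, Int.card_Ioc]
    have h0 : 0 ≤ b - (a - k * H) := by linarith
    have h1 : (((b - (a - k * H)).toNat : ℕ) : ℤ) = b - (a - k * H) := Int.toNat_of_nonneg h0
    have h2 : (((b - (a - k * H)).toNat : ℕ) : ℝ) = ((b - (a - k * H) : ℤ) : ℝ) := by exact_mod_cast h1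
    rw [h2]; push_cast; ring
  -- Step 1: `H S = ∑_{m ∈ M} ∑_{j < H} z(m + k j)`
  have hshift : ∀ j ∈ range H, ∑ m ∈ M, z (m + k * j) = S := by
    intro j hj
    rw [mem_range] at hj
    rw [hM, sum_Ioc_shift', hS]
    have hj' : k * j ≤ k * H := by
      have : (j : ℤ) ≤ H := by exact_mod_cast hj.le
      nlinarith
    have hj0 : 0 ≤ k * (j : ℤ) := by positivity
    exact sum_eq_sum_of_vanish' (Ioc_subset_Ioc (by linarith) (by linarith)) hz
  have hHS : (H : ℂ) • S = ∑ m ∈ M, ∑ j ∈ range H, z (m + k * j) := by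
    rw [sum_comm, sum_congr rfl hshift, sum_const, card_range, ← Nat.cast_smul_eq_nsmul ℂ]
  -- Step 2: Cauchy–Schwarz
  have hCS := norm_sq_sum_le_card_mul' M (fun m => ∑ j ∈ range H, z (m + k * j))
  -- Step 3: expand the squares
  have hexp : ∑ m ∈ M, ‖∑ j ∈ range H, z (m + k * j)‖ ^ 2 =
      ∑ j ∈ range H, ∑ j' ∈ range H, (corrE z a b (k * ((j : ℤ) - j'))).re := by
    rw [sum_congr rfl fun m _ => norm_sq_sum_eq_re_inner _ (fun j => z (m + k * j)), sum_comm]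
    refine sum_congr rfl fun j hj => ?_
    rw [sum_comm]
    refine sum_congr rfl fun j' hj' => ?_
    rw [← Complex.re_sum]
    congr 1
    rw [mem_range] at hj hj'
    have h2 := sum_Ioc_shift' (fun n => ⟪z (n + k * ((j : ℤ) - j')), z n⟫_ℂ) (a - k * H) b (k * j')
    have h3 : ∀ m : ℤ, ⟪z (m + k * j), z (m + k * j')⟫_ℂ =
        ⟪z (m + k * j' + k * ((j : ℤ) - j')), z (m + k * j')⟫_ℂ := by
      intro m
      have : m + k * j' + k * ((j : ℤ) - j') = m + k * j := by ring
      rw [this]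
    rw [hM, sum_congr rfl (fun m _ => h3 m), h2, corrE]
    have hj0 : 0 ≤ k * (j' : ℤ) := by positivity
    have hj'' : k * (j' : ℤ) ≤ k * H := by
      have : (j' : ℤ) ≤ H := by exact_mod_cast hj'.le
      nlinarith
    apply sum_eq_sum_of_vanish' (Ioc_subset_Ioc (by linarith) (by linarith))
    intro n hn
    rw [hz n hn, inner_zero_right]
  -- Step 4: bound the double sum of correlations
  have hcorr : ∑ j ∈ range H, ∑ j' ∈ range H, (corrE z a b (k * ((j : ℤ) - j'))).re ≤
      H * (∑ n ∈ Ioc a b, ‖z n‖ ^ 2 + 2 * ∑ d ∈ Ico (1 : ℤ) H, ‖corrE z a b (k * d)‖) := by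
    have hg0 : ∀ d ∈ Ico (1 : ℤ) H, 0 ≤ ‖corrE z a b (k * d)‖ := fun d _ => norm_nonneg _
    have hrow : ∀ j ∈ range H, ∑ j' ∈ range H, (corrE z a b (k * ((j : ℤ) - j'))).re ≤
        ∑ n ∈ Ioc a b, ‖z n‖ ^ 2 + 2 * ∑ d ∈ Ico (1 : ℤ) H, ‖corrE z a b (k * d)‖ := by
      intro j hj
      rw [mem_range] at hj
      have hle : ∀ j' ∈ range H, (corrE z a b (k * ((j : ℤ) - j'))).re ≤
          ‖corrE z a b (k * ((j : ℤ) - j'))‖ := fun j' _ => Complex.re_le_norm _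
      refine (sum_le_sum hle).trans ?_
      rw [range_eq_Ico, ← sum_Ico_consecutive _ (Nat.zero_le j) hj.le,
        sum_eq_sum_Ico_succ_bot hj, sub_self, mul_zero, corrE_zero, Complex.norm_real,
        Real.norm_of_nonneg (sum_nonneg fun _ _ => sq_nonneg _)]
      -- lower part: d = j - j' ∈ [1, j]
      have hlow : ∑ j' ∈ Ico 0 j, ‖corrE z a b (k * ((j : ℤ) - j'))‖ ≤
          ∑ d ∈ Ico (1 : ℤ) H, ‖corrE z a b (k * d)‖ := by
        rw [← sum_image (f := fun d : ℤ => ‖corrE z a b (k * d)‖)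
          (s := Ico 0 j) (g := fun j' : ℕ => (j : ℤ) - j')]
        · apply sum_le_sum_of_subset_of_nonneg
          · intro d hd
            rw [mem_image] at hd
            obtain ⟨j', hj', rfl⟩ := hd
            rw [mem_Ico] at hj' ⊢
            omega
          · intro d _ _; exact norm_nonneg _
        · intro x _ y _ hxy
          have : (x : ℤ) = y := by linarith
          exact_mod_cast this
      -- upper part: d = j' - j ∈ [1, H - 1 - j], using `‖C(-d)‖ = ‖C d‖`
      have hup : ∑ j' ∈ Ico (j + 1) H, ‖corrE z a b (k * ((j : ℤ) - j'))‖ ≤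
          ∑ d ∈ Ico (1 : ℤ) H, ‖corrE z a b (k * d)‖ := by
        have hsymm : ∀ j' ∈ Ico (j + 1) H,
            ‖corrE z a b (k * ((j : ℤ) - j'))‖ = ‖corrE z a b (k * ((j' : ℤ) - j))‖ := by
          intro j' _
          have : k * ((j : ℤ) - j') = -(k * ((j' : ℤ) - j)) := by ring
          rw [this, norm_corrE_neg hz]
        rw [sum_congr rfl hsymm, ← sum_image (f := fun d : ℤ => ‖corrE z a b (k * d)‖)
            (s := Ico (j + 1) H) (g := fun j' : ℕ => (j' : ℤ) - j)]
        · apply sum_le_sum_of_subset_of_nonneg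
          · intro d hd
            rw [mem_image] at hd
            obtain ⟨j', hj', rfl⟩ := hd
            rw [mem_Ico] at hj' ⊢
            omega
          · intro d _ _; exact norm_nonneg _
        · intro x _ y _ hxy
          have : (x : ℤ) = y := by linarith
          exact_mod_cast this
      have hsum0 : 0 ≤ ∑ d ∈ Ico (1 : ℤ) H, ‖corrE z a b (k * d)‖ := sum_nonneg hg0
      linarith
    calc ∑ j ∈ range H, ∑ j' ∈ range H, (corrE z a b (k * ((j : ℤ) - j'))).re
        ≤ ∑ _j ∈ range H, (∑ n ∈ Ioc a b, ‖z n‖ ^ 2 + 2 * ∑ d ∈ Ico (1 : ℤ) H, ‖corrE z a b (k * d)‖) :=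
          sum_le_sum hrow
      _ = H * (∑ n ∈ Ioc a b, ‖z n‖ ^ 2 + 2 * ∑ d ∈ Ico (1 : ℤ) H, ‖corrE z a b (k * d)‖) := by
          rw [sum_const, card_range, nsmul_eq_mul]
  -- assemble
  have hnormHS : (H : ℝ) ^ 2 * ‖S‖ ^ 2 = ‖(H : ℂ) • S‖ ^ 2 := by
    rw [norm_smul, Complex.norm_natCast]; ring
  rw [hnormHS, hHS]
  calc ‖∑ m ∈ M, ∑ j ∈ range H, z (m + k * j)‖ ^ 2
      ≤ M.card * ∑ m ∈ M, ‖∑ j ∈ range H, z (m + k * j)‖ ^ 2 := hCS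
    _ = ((b : ℝ) - a + k * H) * ∑ j ∈ range H, ∑ j' ∈ range H,
          (corrE z a b (k * ((j : ℤ) - j'))).re := by rw [hcardM, hexp]
    _ ≤ ((b : ℝ) - a + k * H) * (H * (∑ n ∈ Ioc a b, ‖z n‖ ^ 2 +
          2 * ∑ d ∈ Ico (1 : ℤ) H, ‖corrE z a b (k * d)‖)) := by
        apply mul_le_mul_of_nonneg_left hcorr
        have : (a : ℝ) ≤ b := by exact_mod_cast hab
        have hkH' : (0 : ℝ) ≤ k * H := by exact_mod_cast hkH
        linarith

end Support

end Literature.NumberTheory.LFunctions.MauduitRivat
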